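/-
Copyright (c) 2026. All rights reserved.
Released under Apache 2.0 license as described in the file LICENSE.
Authors: abc-iut cell — seat abc-iut-w5-d058 (wave 5; §4(iii) non-vacuity programme, layer L4: the Def 5.1 / 5.6
theater tower of [AbsTopIII] §5 and its named-fact package at the TRIVIAL-GROUP context).
-/
import Mathlib.Algebra.Module.PUnit
import Mathlib.Algebra.Field.ULift
import Literature.AnabelianGeometry.AbsoluteAnabelian.PanalocalTheaters
import HarnessLib

/-!
# [AbsTopIII] §5 theaters: generic identity morphisms, and the named-fact package at the trivial-group context

S. Mochizuki, *Topics in absolute anabelian geometry III* [MochizukiAbsTopIII2015], Def 5.1 (ii)–(iv) pp. 113–116,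
Rmk 5.1.1 p. 118, Cor 5.2 (i) p. 119, (v) p. 120, Def 5.6 (ii) p. 135.

abc-iut-w5-d197's INHABITATION-CENSUS-L4 v1 (04:2xZ) and abc-iut-w5-d056's cell census v3 list, among the layer-L4
records with ZERO kernel producers, `GlobalGaloisTheater.Hom` and `MonoAnalyticGaloisTheater` (the general identity
of `MonoAnalyticGaloisTheater.Hom` / `PanalocalTPair(Data).Hom` is abc-iut-L5-t10's `PanalocalHomNonVacuity.lean`); and
the NAMED `Prop` FACTS of `GaloisTheaters.lean` / `PanalocalTheaters.lean`
(`ReferenceIsoUnique`, `TheaterHomDeterminedByGroupHom`, `TheaterIsoCanonical`, `EAHomExtendsToTheaters`,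
`PanalocalizationExists`, `PanalocalizationMapsHom`, `MonoAnalyticizationExists` — assumptions on the context `R` that
hold for the genuine context of Thm 1.9 / Cor 2.8) have never been verified at ANY instance.  This PROOF-ONLY file
(no `def` / `instance` / `structure` / notation) records:

* GENERIC lemmas, valid for every context `R`:
  `GlobalGaloisTheater.nonempty_hom_self_of_forall_notMem_arc` — a global Galois-theater WITHOUT archimedean
  elements carries its identity endomorphism (at archimedean `v` the identity would in addition need
  `R.mapKNF (𝟙 Π) = id`, which the context record does not assert — an OBSERVATION on the interface, recorded here);
  `theaterIsoCanonical_of_forall_notMem_arc` (Cor 5.2 (i), essential surjectivity, holds for every `R` whose canonical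
  pro-sets have no archimedean elements); `referenceIsoUnique_of_subsingleton`,
  `theaterHomDeterminedByGroupHom_of_subsingleton`, `eaHomExtendsToTheaters_of_subsingleton` (Rmk 5.1.1, Cor 5.2 (i)
  full faithfulness, for every `R` whose canonical pro-sets are one-point); `panalocalizationExists_of_forall_notMem`,
  `panalocalizationMapsHom_of_forall_notMem`, `monoAnalyticizationExists_of_forall_notMem` (Def 5.1 (iv) /
  Cor 5.2 (v) / Def 5.6 (ii) for every `R` whose canonical pro-sets have no local elements);
* the **TRIVIAL-GROUP CONTEXT** `GlobalAnabelianContext.exists_trivialGroupContext`: `Ob(EA⊚) := {Π : Π = 1}`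
  (`IsAdmissible E := Subsingleton E.arith`, transported along isomorphisms of extensions; `Δ = Π = 1` IS the maximal
  topologically finitely generated closed normal subgroup), `k_NF := ℚ` (trivial action), `V⊚(Π) := {⊚}`;
* the headline `GlobalAnabelianContext.exists_context_theaterFacts`: at that context `Ob(EA⊚)` is inhabited (by
  `Π = G = 1`), `GlobalGaloisTheater`, `GlobalGaloisTheater.Hom`, `PanalocalGaloisTheater`, `MonoAnalyticGaloisTheater`
  (for every archimedean mono-analyticization datum `ma`) are all inhabited, and the seven named facts above HOLD
  SIMULTANEOUSLY — i.e. the assumption package of [AbsTopIII] §5 typed in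
  `GaloisTheaters.lean` / `PanalocalTheaters.lean` is JOINTLY SATISFIABLE.

HONEST LABEL (binding, abc-iut-L4-lead RULING #5a (6)): these are SATISFIABILITY witnesses at trivial /
archimedean-free contexts, NOT discharges of the seven named facts at the intended model — the facts stay fact-open at
the model (FACT policy); DEGENERATE (no hyperbolic orbicurve has `Π = 1`; the genuine context = étale `π₁` + [AbsTopIII]
Thm 1.9 / Cor 2.8–2.9 is not in the tree, FOUNDATIONS row 12).  Consistency / packaging facts about the cell's own
interface records; nothing of [AbsTopIII] is asserted; instantiated ≠ endorsed; nothing here bears on the disputed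
[IUTchIII] Cor. 3.12.  The interface observation on `R.mapKNF (𝟙 Π)` is booked as note I-L4-t3-1 (not a defect).
-/

namespace Literature.AnabelianGeometry.AbsoluteAnabelian

open CategoryTheory Topology

universe u

/-! ### Generic identity morphisms and named facts under «no local elements» hypotheses -/

section Generic

variable {R : GlobalAnabelianContext.{u}}

/-- The identity of `Π` is a morphism of `EA⊚`. [cite: MochizukiAbsTopIII2015, Def 5.1 (iii) p. 115] -/
theorem isEAHom_id (E : FundamentalExtension.{u}) : IsEAHom (𝟙 E) :=
  { FundamentalExtension.Hom.IsBaseChange.id E with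
    injective := (FundamentalExtension.Hom.IsOpenInjective.id E).arith_injective
    isOpen_range := (FundamentalExtension.Hom.IsOpenInjective.id E).isOpen_range_arith }

/-- **A global Galois-theater without archimedean elements has an identity endomorphism** (`φ_Π := 𝟙`,
`φ_V := id`; condition (b) is vacuous).  OBSERVATION: at an archimedean `v` the identity would also need
`R.mapKNF (𝟙 Π) = id`, which the context record does not assert. [cite: MochizukiAbsTopIII2015, Def 5.1 (iii) pp. 115–116] -/
theorem GlobalGaloisTheater.nonempty_hom_self_of_forall_notMem_arc (T : GlobalGaloisTheater R)
    (harc : ∀ v, v ∉ T.V.arc) : Nonempty (T.Hom T) :=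
  ⟨{ φgrp := 𝟙 T.ext
     isEAHom := isEAHom_id T.ext
     φV := Homeomorph.refl _
     φV_smul := fun _ _ => rfl
     φV_generic := rfl
     image_non := Set.image_id _
     image_arc := Set.image_id _
     arch_compat := fun v _ => (harc v v.2).elim }⟩

variable (R)

/-- **Cor 5.2 (i), essential surjectivity, for every context whose canonical pro-sets have no archimedean
elements**: the reference isomorphism `ψ_V` of a theater IS a morphism `V⊚(Π) → V⊚` over `𝟙 Π` (condition (b) being
vacuous). [cite: MochizukiAbsTopIII2015, Cor 5.2 (i) p. 119] -/
theorem theaterIsoCanonical_of_forall_notMem_arc (harc : ∀ E v, v ∉ (R.proVal E).arc) : TheaterIsoCanonical R := by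
  intro T
  obtain ⟨ψ, hsmul, hgen, hnon, harc', -⟩ := T.exists_referenceIso
  exact ⟨{ φgrp := 𝟙 T.ext
           isEAHom := isEAHom_id T.ext
           φV := ψ
           φV_smul := hsmul
           φV_generic := hgen
           image_non := hnon
           image_arc := harc'
           arch_compat := fun v _ => (harc T.ext v v.2).elim }, rfl⟩

/-- **Rmk 5.1.1 (uniqueness of `ψ_V`) for every context with one-point canonical pro-sets.**
[cite: MochizukiAbsTopIII2015, Rmk 5.1.1 p. 118] -/
theorem referenceIsoUnique_of_subsingleton (hs : ∀ E, Subsingleton (R.proVal E).carrier) :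
    ReferenceIsoUnique R := by
  intro T ψ₁ ψ₂ _ _
  haveI := hs T.ext
  ext v
  rw [← ψ₁.apply_symm_apply (ψ₂ v), Subsingleton.elim (ψ₁.symm (ψ₂ v)) v]

/-- **Rmk 5.1.1, last sentence (`φ_V` determined by `φ_Π`) for every context with one-point canonical pro-sets.**
[cite: MochizukiAbsTopIII2015, Rmk 5.1.1 p. 118] -/
theorem theaterHomDeterminedByGroupHom_of_subsingleton (hs : ∀ E, Subsingleton (R.proVal E).carrier) :
    TheaterHomDeterminedByGroupHom R := by
  intro T₁ T₂ φ φ' _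
  obtain ⟨ψ, -⟩ := T₂.exists_referenceIso
  haveI := hs T₂.ext
  ext v
  exact ψ.symm.injective (Subsingleton.elim _ _)

/-- **Cor 5.2 (i), full faithfulness, for every context with one-point canonical pro-sets** (`φ_V := V⊚(f)`).
[cite: MochizukiAbsTopIII2015, Cor 5.2 (i) p. 119] -/
theorem eaHomExtendsToTheaters_of_subsingleton (hs : ∀ E, Subsingleton (R.proVal E).carrier)
    (hnon : ∀ E v, v ∉ (R.proVal E).non) (harc : ∀ E v, v ∉ (R.proVal E).arc) : EAHomExtendsToTheaters R := by
  intro E₁ E₂ h₁ h₂ f hf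
  haveI := hs E₂
  refine ⟨{ φgrp := f
            isEAHom := hf
            φV := R.mapProVal f hf
            φV_smul := R.mapProVal_smul f hf
            φV_generic := Subsingleton.elim _ _
            image_non := ?_
            image_arc := ?_
            arch_compat := fun v _ => (harc E₁ v v.2).elim }, rfl⟩
  · change (R.mapProVal f hf) '' (R.proVal E₁).non = (R.proVal E₂).non
    rw [Set.eq_empty_iff_forall_notMem.mpr (hnon E₁), Set.eq_empty_iff_forall_notMem.mpr (hnon E₂),
      Set.image_empty]
  · change (R.mapProVal f hf) '' (R.proVal E₁).arc = (R.proVal E₂).arc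
    rw [Set.eq_empty_iff_forall_notMem.mpr (harc E₁), Set.eq_empty_iff_forall_notMem.mpr (harc E₂),
      Set.image_empty]

/-- In a context without local elements every element of `V⊚(Π)/Aut(Π)` is the class of `⊚`.
[cite: MochizukiAbsTopIII2015, Def 5.1 (ii) p. 115] -/
theorem toModAut_eq_generic_of_forall_notMem (hnon : ∀ E v, v ∉ (R.proVal E).non)
    (harc : ∀ E v, v ∉ (R.proVal E).arc) (E : FundamentalExtension.{u}) (q : R.ProValModAut E) :
    q = R.toModAut E (R.proVal E).generic := by
  induction q using Quot.ind with
  | mk v =>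
    rcases (R.proVal E).eq_generic_or_mem v with h | h | h
    · rw [h]; rfl
    · exact (hnon E v h).elim
    · exact (harc E v h).elim

/-- **Def 5.1 (iv) / Cor 5.2 (v), object part, for every context without local elements**: the panalocalization of
`V⊚(Π)` is the one-point theater `V⊚ := V⊚(Π)/Aut(Π) = {⊚}` (reference bijection the identity).
[cite: MochizukiAbsTopIII2015, Cor 5.2 (v) p. 120] -/
theorem panalocalizationExists_of_forall_notMem (hnon : ∀ E v, v ∉ (R.proVal E).non)
    (harc : ∀ E v, v ∉ (R.proVal E).arc) : PanalocalizationExists R := by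
  intro E hE
  have href : IsPanalocalReferenceFor R (R.toModAut E (R.proVal E).generic) (∅ : Set (R.ProValModAut E)) ∅
      (fun v => v.2.elim) (fun v => v.2.elim) E (Equiv.refl _) :=
    ⟨rfl, fun v hv => (hnon E v hv).elim, fun v hv => (harc E v hv).elim, fun v => v.2.elim, fun v => v.2.elim⟩
  exact ⟨{ V := R.ProValModAut E
           generic := R.toModAut E (R.proVal E).generic
           non := ∅
           arc := ∅
           generic_notMem_non := fun h => h
           generic_notMem_arc := fun h => h
           disjoint_non_arc := disjoint_bot_left
           eq_generic_or_mem := fun q => Or.inl (toModAut_eq_generic_of_forall_notMem R hnon harc E q)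
           grp := fun v => v.2.elim
           X := fun v => v.2.elim
           exists_reference := ⟨E, hE, Equiv.refl _, href⟩ }, hE, Equiv.refl _, href⟩

variable {R} in
/-- Over a context without local elements, a panalocal Galois-theater has no local elements either (its reference
bijection surjects `V(Π)^non ↠ V^non`, `V(Π)^arc ↠ V^arc`) and its underlying set is the singleton `{⊚}`.
[cite: MochizukiAbsTopIII2015, Def 5.1 (iv) p. 116] -/
theorem PanalocalGaloisTheater.forall_notMem_of_forall_notMem (hnon : ∀ E v, v ∉ (R.proVal E).non)
    (harc : ∀ E v, v ∉ (R.proVal E).arc) (P : PanalocalGaloisTheater R) :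
    (∀ v, v ∉ P.non) ∧ (∀ v, v ∉ P.arc) ∧ ∀ v : P.V, v = P.generic := by
  obtain ⟨E, hE, ψ, hgen, -, -, hn, ha⟩ := P.exists_reference
  refine ⟨fun v hv => ?_, fun v hv => ?_, fun v => ?_⟩
  · obtain ⟨vl, hvl, -⟩ := hn ⟨v, hv⟩
    exact hnon E vl hvl
  · obtain ⟨vl, -⟩ := ha ⟨v, hv⟩
    exact harc E vl.1 vl.2
  · rw [← hgen, ← ψ.apply_symm_apply v, toModAut_eq_generic_of_forall_notMem R hnon harc E (ψ.symm v)]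

/-- **Def 5.1 (iv) / Cor 5.2 (v), morphism part (weak form), for every context without local elements**: any two
panalocal Galois-theaters are one-point, hence related by a (unique) morphism. [cite: MochizukiAbsTopIII2015, Def 5.1 (iv) p. 116] -/
theorem panalocalizationMapsHom_of_forall_notMem (hnon : ∀ E v, v ∉ (R.proVal E).non)
    (harc : ∀ E v, v ∉ (R.proVal E).arc) : PanalocalizationMapsHom R := by
  intro E₁ E₂ P₁ P₂ _ _ f _
  obtain ⟨hn₁, ha₁, hV₁⟩ := P₁.forall_notMem_of_forall_notMem hnon harc
  obtain ⟨-, -, hV₂⟩ := P₂.forall_notMem_of_forall_notMem hnon harc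
  exact ⟨{ φV := { toFun := fun _ => P₂.generic, invFun := fun _ => P₁.generic,
                   left_inv := fun v => (hV₁ v).symm, right_inv := fun v => (hV₂ v).symm }
           φV_generic := rfl
           image_non := by
             rw [Set.eq_empty_iff_forall_notMem.mpr hn₁, Set.image_empty,
               Set.eq_empty_iff_forall_notMem.mpr (P₂.forall_notMem_of_forall_notMem hnon harc).1]
           image_arc := by
             rw [Set.eq_empty_iff_forall_notMem.mpr ha₁, Set.image_empty,
               Set.eq_empty_iff_forall_notMem.mpr (P₂.forall_notMem_of_forall_notMem hnon harc).2.1]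
           non_mem := fun v => (hn₁ v v.2).elim
           arc_mem := fun v => (ha₁ v v.2).elim
           grpHom := fun v => (hn₁ v v.2).elim
           grpHom_isOpenInjection := fun v => (hn₁ v v.2).elim
           archIso := fun v => (ha₁ v v.2).elim }⟩

/-- **Def 5.6 (ii), the mono-analyticization `Th✠ → Th⊢`, object part, for every context without local elements**:
`W⊚ := V⊚` with no local data (reference bijection the identity). [cite: MochizukiAbsTopIII2015, Def 5.6 (ii) p. 135] -/
theorem monoAnalyticizationExists_of_forall_notMem (ma : ArchMonoAnalyticization.{u})
    (hnon : ∀ E v, v ∉ (R.proVal E).non) (harc : ∀ E v, v ∉ (R.proVal E).arc) :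
    MonoAnalyticizationExists R ma := by
  intro P
  obtain ⟨hn, ha, -⟩ := P.forall_notMem_of_forall_notMem hnon harc
  obtain ⟨E, hE, ψP, hP⟩ := P.exists_reference
  have href : IsMonoAnalyticReferenceFor R ma P.generic P.non P.arc (fun w => (hn w w.2).elim)
      (fun w => (hn w w.2).elim) (fun w => (ha w w.2).elim) (fun w => (ha w w.2).elim) P (Equiv.refl _) :=
    ⟨rfl, Set.image_id _, Set.image_id _, ⟨E, hE, ψP, hP, fun v => (hn v v.2).elim⟩, fun v => (ha v v.2).elim⟩
  exact ⟨{ W := P.V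
           generic := P.generic
           non := P.non
           arc := P.arc
           generic_notMem_non := P.generic_notMem_non
           generic_notMem_arc := P.generic_notMem_arc
           disjoint_non_arc := P.disjoint_non_arc
           eq_generic_or_mem := P.eq_generic_or_mem
           G := fun w => (hn w w.2).elim
           isMLFGaloisType := fun w => (hn w w.2).elim
           piClass := fun w => (hn w w.2).elim
           piClass_iso := fun w => (hn w w.2).elim
           M := fun w => (ha w w.2).elim
           xClass := fun w => (ha w w.2).elim
           xClass_iso := fun w => (ha w w.2).elim
           exists_reference := ⟨P, Equiv.refl _, href⟩ }, Equiv.refl _, href⟩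

end Generic

/-! ### The trivial-group context -/

/-- **The TRIVIAL-GROUP context**: `Ob(EA⊚) := {Π ↠ G : Π = 1}` (`IsAdmissible E := Subsingleton E.arith`, stable
under isomorphisms of extensions; for such `Π` the subgroup `Δ = 1` IS the maximal topologically finitely generated
closed normal subgroup, so the law `geom_isMax` HOLDS rather than being vacuous), `k_NF(Π) := ℚ` with the trivial
action, `V⊚(Π) := {⊚}`, `V⊚(f) := id`, `k_NF(f) := id`.  DEGENERATE (no hyperbolic orbicurve has `Π = 1`).
[cite: MochizukiAbsTopIII2015, Def 5.1 (ii) p. 114] -/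
theorem GlobalAnabelianContext.exists_trivialGroupContext :
    ∃ R : GlobalAnabelianContext.{u}, (∀ E, R.IsAdmissible E ↔ Subsingleton E.arith) ∧
      (∀ E, Subsingleton (R.proVal E).carrier) ∧ (∀ E v, v ∉ (R.proVal E).non) ∧ (∀ E v, v ∉ (R.proVal E).arc) := by
  let V : ∀ E : FundamentalExtension.{u}, GaloisProSet E.arith := fun E =>
    { carrier := PUnit.{u + 1}
      continuousSMul := ⟨continuous_const (y := PUnit.unit)⟩
      generic := PUnit.unit
      non := ∅
      arc := ∅
      smul_generic := fun _ => rfl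
      generic_notMem_non := fun h => h
      generic_notMem_arc := fun h => h
      disjoint_non_arc := disjoint_bot_left
      eq_generic_or_mem := fun _ => Or.inl rfl
      smul_mem_non := fun _ _ h => h.elim
      smul_mem_arc := fun _ _ h => h.elim }
  have hiso : ∀ {E₁ E₂ : FundamentalExtension.{u}}, Nonempty (E₁ ≅ E₂) →
      Subsingleton E₁.arith → Subsingleton E₂.arith := by
    rintro E₁ E₂ ⟨e⟩ h
    refine ⟨fun a b => ?_⟩
    have ha : (e.inv ≫ e.hom).arith a = a := by rw [e.inv_hom_id]; rfl
    have hb : (e.inv ≫ e.hom).arith b = b := by rw [e.inv_hom_id]; rfl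
    rw [← ha, ← hb, FundamentalExtension.comp_arith]
    exact congrArg e.hom.arith (Subsingleton.elim _ _)
  have hmax : ∀ E : FundamentalExtension.{u}, Subsingleton E.arith → IsMaxTopFGClosedNormal E.geom := by
    intro E hE
    exact
      { normal := inferInstanceAs E.aug.toMonoidHom.ker.Normal
        isClosed := E.isClosed_geom
        topFG := ⟨∅, eq_top_iff.mpr fun x _ => by rw [Subsingleton.elim x 1]; exact one_mem _⟩
        maximal := fun N _ _ _ x _ => by rw [Subsingleton.elim x 1]; exact one_mem _ }
  exact
    ⟨{ IsAdmissible := fun E => Subsingleton E.arith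
       isAdmissible_of_iso := hiso
       geom_isMax := hmax
       kNF := fun _ => ULift.{u} ℚ
       instField := fun _ => inferInstance
       instAction := fun E => MulSemiringAction.compHom _ (1 : E.arith →* (ULift.{u} ℚ →+* ULift.{u} ℚ))
       proVal := V
       archSpace := fun _ v => v.2.elim
       δell := fun _ v => v.2.elim
       κell := fun _ v => v.2.elim
       mapProVal := fun _ _ => Homeomorph.refl _
       mapProVal_smul := fun _ _ _ _ => rfl
       mapKNF := fun _ _ => RingEquiv.refl _ },
      fun _ => Iff.rfl, fun _ => inferInstanceAs (Subsingleton PUnit), fun _ _ h => h, fun _ _ h => h⟩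

/-- **The [AbsTopIII] §5 assumption package is JOINTLY SATISFIABLE (at the trivial-group context).**  There is a
context `R` with: `Ob(EA⊚)` inhabited (by `Π = G = 1`); `GlobalGaloisTheater R`, `GlobalGaloisTheater.Hom`,
`PanalocalGaloisTheater R`, `MonoAnalyticGaloisTheater R ma` (every `ma`) inhabited; and Rmk 5.1.1 (both clauses), Cor 5.2 (i) (both halves), Cor 5.2 (v) object + weak morphism parts, Def 5.6 (ii)
object part ALL HOLDING.  SATISFIABILITY witness at a DEGENERATE model, NOT a discharge of the seven facts at the
intended model (they stay fact-open there); instantiated ≠ endorsed. [cite: MochizukiAbsTopIII2015, Cor 5.2 (i) p. 119] -/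
theorem GlobalAnabelianContext.exists_context_theaterFacts :
    ∃ R : GlobalAnabelianContext.{u},
      (∃ E, R.IsAdmissible E) ∧ Nonempty (GlobalGaloisTheater R) ∧
      (∃ T : GlobalGaloisTheater R, Nonempty (T.Hom T)) ∧ Nonempty (PanalocalGaloisTheater R) ∧
      (∀ ma : ArchMonoAnalyticization.{u}, Nonempty (MonoAnalyticGaloisTheater R ma) ∧
        MonoAnalyticizationExists R ma) ∧
      ReferenceIsoUnique R ∧ TheaterHomDeterminedByGroupHom R ∧ TheaterIsoCanonical R ∧
      EAHomExtendsToTheaters R ∧ PanalocalizationExists R ∧ PanalocalizationMapsHom R := by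
  obtain ⟨R, hadm, hs, hnon, harc⟩ := GlobalAnabelianContext.exists_trivialGroupContext.{u}
  -- the point extension `Π = G = 1`
  let E₁ : FundamentalExtension.{u} :=
    { arith := ProfiniteGrp.of PUnit.{u + 1}, gal := ProfiniteGrp.of PUnit.{u + 1},
      aug := ContinuousMonoidHom.id _, aug_surjective := Function.surjective_id }
  have hE₁ : R.IsAdmissible E₁ := (hadm E₁).mpr (inferInstanceAs (Subsingleton PUnit))
  have hPan := panalocalizationExists_of_forall_notMem R hnon harc
  obtain ⟨P₁, -⟩ := hPan E₁ hE₁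
  refine ⟨R, ⟨E₁, hE₁⟩, ⟨R.theater E₁ hE₁⟩,
    ⟨R.theater E₁ hE₁, (R.theater E₁ hE₁).nonempty_hom_self_of_forall_notMem_arc (harc E₁)⟩, ⟨P₁⟩,
    fun ma => ⟨?_, monoAnalyticizationExists_of_forall_notMem R ma hnon harc⟩,
    referenceIsoUnique_of_subsingleton R hs, theaterHomDeterminedByGroupHom_of_subsingleton R hs,
    theaterIsoCanonical_of_forall_notMem_arc R harc, eaHomExtendsToTheaters_of_subsingleton R hs hnon harc,
    hPan, panalocalizationMapsHom_of_forall_notMem R hnon harc⟩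
  obtain ⟨T, -⟩ := monoAnalyticizationExists_of_forall_notMem R ma hnon harc P₁
  exact ⟨T⟩

end Literature.AnabelianGeometry.AbsoluteAnabelian
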